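import Mathlib
import Summits.ValiantsHypothesis.ValiantsHypothesis.Theorems.GrenetZeonTwoDimCoefficientsScalingBlockTriangularCoupling

/-!
# Crux `GrenetZeon.TwoDimCoefficients` (stmt-ValiantsHypothesis-8062) / rung `DualUnipotentThreeHalves` (stmt-24318):
# scaling-closure — INVISIBLE COUPLING IS FREE: block-triangular pencils without back-coupling obey the 3/2 rung

Two corollaries of the ledger inequality ✓ `sq_sub_rank_mul_le_of_levelCut` (p838815) that enlarge the unconditional
class of ✓ `sq_sub_mul_le_of_blockDiagonal_goodOrGarbage` (p838515, block-DIAGONAL pencils) to genuinely block-TRIANGULAR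
ones.  In the normal form `per_n = tr(N^{n−1}·M)` (✓ `exists_nilpotent_pencil_of_dualUnipotentRepr`) let `N` be level-cut for
`lvl` (`N i j = 0` whenever `lvl i < lvl j`: the coupling blocks of `N` ACROSS levels are arbitrary in one direction) with every
class pencil of nil-index `≤ n`.

* ★ `cube_le_two_mul_sum_sq_of_levelCut_cutTerm_eq_zero` — if the cut term `tr(N^{n−1}·M^cut)` vanishes as a polynomial,
  then `n³ ≤ 2·Σ_p s_p²` (`≤ 2m²`).
* ★ `cube_le_two_mul_sum_sq_of_levelCut_noBackCoupling` — in particular if `M` has NO entries at the cut positions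
  (`M i j = 0` whenever `lvl i < lvl j`: no back-coupling), the coupling `C` inside `N` is completely invisible and the
  3/2 rung holds, however large the nil-index of the whole pencil `N` (up to `L·n` for `L` levels).

So the located residual (P3) is exactly the case `C ≠ 0` AND `M^cut ≠ 0` with `tr(N^{n−1}·M^cut) ≢ 0`.

HONEST FRAMING: unconditional for the stated class; no stub is closed: `DualUnipotentBound`, crux 8062, the 24318 decl and
`VP ≠ VNP` remain open.

References: T. Mignon, N. Ressayre, Int. Math. Res. Not. 2004:79, Thm. 1.1 (via the tree); folklore.
-/

-- single-conjunct layout `Summits/ValiantsHypothesis/ValiantsHypothesis`: the duplicated namespace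
-- component is mandated by the tree.
set_option linter.dupNamespace false
set_option autoImplicit false

noncomputable section

namespace Summit.ValiantsHypothesis.ValiantsHypothesis.Theorems.GrenetZeonTwoDimCoefficients.ScalingClosure

open MvPolynomial Matrix
open Literature.Computability.AlgebraicComplexity
open Summit.ValiantsHypothesis.ValiantsHypothesis.Cruxes.TwoDimCoefficients.DimTwoCases
open Summit.ValiantsHypothesis.ValiantsHypothesis.Theorems.GrenetZeon.SlowCore

section NoBackCoupling

variable {n m : ℕ}

/-- ★ **A level-cut pencil with index-`n` classes whose cut term vanishes obeys `n³ ≤ 2·Σ_p s_p²`.**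
[cite: MignonRessayre2004, Thm. 1.1 — via the tree; folklore] -/
theorem cube_le_two_mul_sum_sq_of_levelCut_cutTerm_eq_zero (hn : 2 ≤ n) (N M : AffMat n m)
    (hN : ∀ i j, (N i j).IsHomogeneous 1) (hM : ∀ i j, (M i j).IsHomogeneous 1)
    (hper : perPoly (Fin n) ℂ = (N ^ (n - 1) * M).trace)
    (lvl : Fin m → ℕ) (hcut : ∀ a b, lvl a < lvl b → N a b = 0)
    (s : ℕ → ℕ) (e : ∀ p : ℕ, {i : Fin m // lvl i = p} ≃ Fin (s p))
    (hindex : ∀ p ∈ Finset.univ.image lvl, (classPencil N (e p)) ^ n = 0)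
    (hzero : (N ^ (n - 1) * Matrix.of (fun i j : Fin m => if lvl i < lvl j then M i j else 0)).trace = 0) :
    n ^ 3 ≤ 2 * ∑ p ∈ Finset.univ.image lvl, s p ^ 2 := by
  classical
  have h := sq_sub_rank_mul_le_of_levelCut hn N M hN hM hper lvl hcut s e (Finset.univ.image lvl)
    (Finset.Subset.refl _) hindex
  have hempty : (Finset.univ.image lvl).filter (fun p => p ∉ Finset.univ.image lvl) = ∅ := by
    ext p
    simp only [Finset.mem_filter, Finset.notMem_empty, iff_false, not_and, not_not]
    exact fun hp => hp
  rw [hempty, Finset.sum_empty, zero_add, hzero, map_zero, map_zero, Matrix.rank_zero, Nat.sub_zero] at h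
  calc n ^ 3 = n ^ 2 * n := by ring
    _ ≤ _ := h

/-- ★ **Invisible coupling is free.**  If `M` has no entries at the cut positions (`M i j = 0` whenever `lvl i < lvl j`),
a level-cut pencil with index-`n` classes obeys `n³ ≤ 2·Σ_p s_p²`, whatever the coupling blocks of `N`.
[cite: MignonRessayre2004, Thm. 1.1 — via the tree; folklore] -/
theorem cube_le_two_mul_sum_sq_of_levelCut_noBackCoupling (hn : 2 ≤ n) (N M : AffMat n m)
    (hN : ∀ i j, (N i j).IsHomogeneous 1) (hM : ∀ i j, (M i j).IsHomogeneous 1)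
    (hper : perPoly (Fin n) ℂ = (N ^ (n - 1) * M).trace)
    (lvl : Fin m → ℕ) (hcut : ∀ a b, lvl a < lvl b → N a b = 0) (hMcut : ∀ a b, lvl a < lvl b → M a b = 0)
    (s : ℕ → ℕ) (e : ∀ p : ℕ, {i : Fin m // lvl i = p} ≃ Fin (s p))
    (hindex : ∀ p ∈ Finset.univ.image lvl, (classPencil N (e p)) ^ n = 0) :
    n ^ 3 ≤ 2 * ∑ p ∈ Finset.univ.image lvl, s p ^ 2 := by
  refine cube_le_two_mul_sum_sq_of_levelCut_cutTerm_eq_zero hn N M hN hM hper lvl hcut s e hindex ?_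
  have hMc : (Matrix.of (fun i j : Fin m => if lvl i < lvl j then M i j else 0)) = 0 := by
    refine Matrix.ext fun i j => ?_
    rw [Matrix.of_apply, Matrix.zero_apply]
    split_ifs with h
    · exact hMcut i j h
    · rfl
  rw [hMc, Matrix.mul_zero, Matrix.trace_zero]

/-- **Sizes add up.**  The class sizes of a labelling sum to `m`, so `Σ_p s_p² ≤ m²`: the bounds above give `n³ ≤ 2m²`.
[folklore] -/
theorem sum_sq_classSize_le_sq (lvl : Fin m → ℕ) (s : ℕ → ℕ) (e : ∀ p : ℕ, {i : Fin m // lvl i = p} ≃ Fin (s p)) :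
    ∑ p ∈ Finset.univ.image lvl, s p ^ 2 ≤ m ^ 2 := by
  classical
  have hs : ∀ p, s p = (Finset.univ.filter (fun i : Fin m => lvl i = p)).card := by
    intro p
    rw [← Fintype.card_fin (s p), ← Fintype.card_congr (e p), Fintype.card_subtype]
  have hsum : ∑ p ∈ Finset.univ.image lvl, s p = m := by
    simp_rw [hs]
    rw [← Finset.card_eq_sum_card_fiberwise (fun i hi => Finset.mem_image_of_mem lvl hi), Finset.card_univ,
      Fintype.card_fin]
  calc ∑ p ∈ Finset.univ.image lvl, s p ^ 2 ≤ (∑ p ∈ Finset.univ.image lvl, s p) ^ 2 := by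
        rw [sq, Finset.sum_mul_sum]
        refine Finset.sum_le_sum fun p hp => ?_
        rw [sq]
        exact Finset.single_le_sum (f := fun q => s p * s q) (fun q _ => Nat.zero_le _) hp
    _ = m ^ 2 := by rw [hsum]

end NoBackCoupling

end Summit.ValiantsHypothesis.ValiantsHypothesis.Theorems.GrenetZeonTwoDimCoefficients.ScalingClosure

end
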